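import Literature.NumberTheory.Automorphic.UnitOrbitalIntegralFixedPoints      -- ★ p839788: `finite_fixedBy_quotient_of_isClosed`, `classOrbitalIntegral_indicator_eq_card_fixedBy` (the `f = 1_K` case)
import Literature.NumberTheory.Automorphic.OrbitalIntegralFixedPointCount       -- ★ `mem_preimage_mul_out_iff`, `pairwiseDisjoint_preimage_mul_out` (the fibres `K · q.out⁻¹`)
import HarnessLib

/-!
# The WEIGHTED fixed-point unfolding of an orbital integral at a compact centraliser:
# `O_γ(f) = ν(K) · Σ_{q ∈ Fix_γ(G ⧸ K)} f(q.out⁻¹ γ q.out)` for `f` supported in `K` and `K`-conjugation invariant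
(Rogawski (1990), §4.9 p. 54 «`Φ(γ, f) = Σ_{x ∈ G_γ\G/K} vol(G_γ ∩ xKx⁻¹)⁻¹ f(x⁻¹γx)`»; Laumon (1996), Lemma (5.3.2) — the weighted twin of the unit count
★ `classOrbitalIntegral_indicator_eq_card_fixedBy`)

Topic `NumberTheory/Automorphic`; namespace `Literature.NumberTheory.Automorphic`.  THEOREMS ONLY (no definition, no instance, no notation, no named fact,
no `sorry`).  Cell `pub/hodgecm-mathlib`, crux H413 = stmt-HodgeConjecture-24833, road «R1LL-tree» (in-house pay-down of the rank-one unstable transfer letter at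
an inert place), brick I-3 «(U1) weighted unfolding» (B-p12 (g29) census 86286e4d §1; architect A-p16 (g27) RULING A-2 (c)); seat F0P2-p01 (g10).
HONEST LABEL: HC_CM is proved only modulo the printed citations until rung 0 closes; this is generic topological-group bookkeeping and asserts nothing printed.

THE MATHEMATICS.  `G` locally compact second countable Hausdorff, `K ≤ G` an open subgroup, `ν` a right-invariant Haar measure, `γ ∈ G`.  For `f : G → E`
with `support f ⊆ K` and `f(k x k⁻¹) = f(x)` (`k ∈ K`), the function `g ↦ f(g γ g⁻¹)` is supported on `{g | g γ g⁻¹ ∈ K} = ⊔_{q ∈ Fix_γ(G⧸K)} K·q.out⁻¹`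
(★ `setOf_conj_mem_eq_biUnion_fixedPoints` ∕ `mem_preimage_mul_out_iff`, ★ `conj_mem_iff_smul_mk_eq`) and is CONSTANT `= f(q.out⁻¹ γ q.out)` on the fibre
`K·q.out⁻¹` (`g = k q.out⁻¹ ⇒ g γ g⁻¹ = k (q.out⁻¹ γ q.out) k⁻¹`), so for finitely many fixed points (§1)
  `∫_G f(g γ g⁻¹) dν(g) = ν(K) · Σ_{q ∈ Fix} f(q.out⁻¹ γ q.out)`.
At a COMPACT centraliser `C = C_G(γ)` with Haar measure `t`, `ν∕t = t(C)⁻¹ · π_*ν` (★ `integral_quotientMeasure_eq_inv_smul`), whence (§2) the orbital integral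
`O_γ^{ν∕t}(f) = (ν(K)∕t(C)) · Σ_{q ∈ Fix} f(q.out⁻¹ γ q.out)` for continuous `f`, and (§3) the CLASS reading for a canonical family `m` (`t(C) = 1`, `ν(K) = 1`,
class of `γ` closed so that `Fix` is finite, ★ `finite_fixedBy_quotient_of_isClosed`):
  `classOrbitalIntegral m f ⟦γ⟧ = ν(K) · Σ_{q ∈ Fix_γ(G⧸K)} f(q.out⁻¹ γ q.out)`  (a `finsum`; `= Σ …` at `ν(K) = 1`).
At `f = 1_K` every term is `1` and this is ★ `classOrbitalIntegral_indicator_eq_card_fixedBy`.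

* §1 `conj_apply_eq_sum_indicator_fixedBy` (the pointwise identity), **`integral_conj_eq_smul_finsum_fixedBy`** (+ `…_of_isClosed`: the plain-integral twin at a
  closed class with compact centraliser, no `m`).
* §2 **`orbitalIntegral_quotientMeasure_eq_smul_finsum_fixedBy`** (`C_G(γ)` compact).
* §3 **`classOrbitalIntegral_eq_sum_fixedBy_of_support_subset_of_conj_invariant`** (canonical `m`, the mass `ν.real K` carried — architect RULING A-4 (b))
  and its unit-mass corollary `…_of_measure_eq_one` (`ν K = 1`; the census head verbatim).

## References
* [Rogawski1990] J. D. Rogawski, *Automorphic Representations of Unitary Groups in Three Variables*, Ann. of Math. Stud. 123 (1990): §4.9 p. 54; §4.3 p. 43.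
* [Laumon1995] G. Laumon, *Cohomology of Drinfeld Modular Varieties* I (1996): Lemma (5.3.2) p. 136.
* [Kottwitz1986] R. E. Kottwitz, *Base change for unit elements of Hecke algebras*, Compositio Math. 60 (1986): §3.
* [Folland1995] G. B. Folland, *A Course in Abstract Harmonic Analysis* (1995): §2.6 (2.52).
-/

set_option autoImplicit false

noncomputable section

open MeasureTheory Measure Topology Filter Set Function
open Literature.MeasureTheory.Group
open scoped ENNReal NNReal Pointwise

namespace Literature.NumberTheory.Automorphic

/-! ## §1 On `G`: `∫ f(g γ g⁻¹) dν(g) = ν(K) · Σ_{q ∈ Fix} f(q.out⁻¹ γ q.out)` -/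

section Group

variable {G : Type*} [Group G] (γ : G) (K : Subgroup G) {E : Type*} [NormedAddCommGroup E] [NormedSpace ℝ E] [CompleteSpace E]

omit [NormedSpace ℝ E] [CompleteSpace E] in
/-- **The pointwise unfolding**: for `f` supported in `K` and `K`-conjugation invariant and finitely many `γ`-fixed points on `G ⧸ K`,
`f(g γ g⁻¹) = Σ_{q ∈ Fix} 1_{K·q.out⁻¹}(g) · f(q.out⁻¹ γ q.out)` — `g ↦ g⁻¹K` sends `{g | g γ g⁻¹ ∈ K}` onto the fixed points with fibres the right cosets
`K·q.out⁻¹ = {g | g·q.out ∈ K}` (★ `mem_preimage_mul_out_iff`, ★ `conj_mem_iff_smul_mk_eq`), pairwise disjoint (★ `pairwiseDisjoint_preimage_mul_out`), and on the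
fibre over `q` one has `g γ g⁻¹ = k (q.out⁻¹ γ q.out) k⁻¹` with `k = g·q.out ∈ K`. [cite: Laumon1995, Lemma (5.3.2) p. 136] [cite: Rogawski1990, §4.9 p. 54] -/
theorem conj_apply_eq_sum_indicator_fixedBy (f : G → E) (hf : support f ⊆ (K : Set G))
    (hfK : ∀ k ∈ K, ∀ x : G, f (k * x * k⁻¹) = f x) (hfin : (MulAction.fixedBy (G ⧸ K) γ).Finite) (g : G) :
    f (g * γ * g⁻¹) =
      ∑ q ∈ hfin.toFinset, ((fun h : G => h * q.out) ⁻¹' (K : Set G)).indicator (fun _ => f (q.out⁻¹ * γ * q.out)) g := by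
  classical
  by_cases hg : ∃ q ∈ hfin.toFinset, g ∈ (fun h : G => h * q.out) ⁻¹' (K : Set G)
  · obtain ⟨q, hq, hgq⟩ := hg
    -- the fibre through `g` is unique
    rw [Finset.sum_eq_single_of_mem q hq fun q' hq' hne => ?_]
    · rw [indicator_of_mem hgq]
      -- `g = k · q.out⁻¹` with `k = g · q.out ∈ K`
      have hk : g * q.out ∈ K := hgq
      have hgγ : g * γ * g⁻¹ = (g * q.out) * (q.out⁻¹ * γ * q.out) * (g * q.out)⁻¹ := by group
      rw [hgγ, hfK _ hk]
    · refine indicator_of_notMem (fun hgq' => ?_) _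
      exact (Set.disjoint_left.1 (pairwiseDisjoint_preimage_mul_out K (hfin.toFinset : Set (G ⧸ K)) (Finset.mem_coe.2 hq')
        (Finset.mem_coe.2 hq) hne) hgq') hgq
  · -- no fibre through `g`: `g γ g⁻¹ ∉ K`, so both sides vanish
    have hg' : ∀ q ∈ hfin.toFinset, g ∉ (fun h : G => h * q.out) ⁻¹' (K : Set G) := fun q hq hgq => hg ⟨q, hq, hgq⟩
    rw [Finset.sum_eq_zero fun q hq => indicator_of_notMem (hg' q hq) _]
    by_contra hne
    have hmem : g * γ * g⁻¹ ∈ (K : Set G) := hf (mem_support.2 hne)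
    have hfix : ((g⁻¹ : G) : G ⧸ K) ∈ MulAction.fixedBy (G ⧸ K) γ :=
      MulAction.mem_fixedBy.2 ((conj_mem_iff_smul_mk_eq γ K g).1 hmem)
    exact hg' _ (hfin.mem_toFinset.2 hfix) ((mem_preimage_mul_out_iff K _ g).2 rfl)

variable [TopologicalSpace G] [IsTopologicalGroup G] [MeasurableSpace G] [BorelSpace G]
  (ν : Measure G) [ν.IsMulRightInvariant]

/-- **`∫_G f(g γ g⁻¹) dν(g) = ν(K) · Σ_{q ∈ Fix_γ(G⧸K)} f(q.out⁻¹ γ q.out)`** for an open subgroup `K` of finite measure, a right-invariant `ν`, `f` supported in `K`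
and `K`-conjugation invariant, finitely many fixed points: integrate §1's pointwise identity fibre by fibre (each fibre `K·q.out⁻¹` has mass `ν(K)`, Mathlib
`measure_preimage_mul_right`). [cite: Laumon1995, Lemma (5.3.2) p. 136] [cite: Rogawski1990, §4.9 p. 54] [cite: Folland1995, §2.6 (2.52)] -/
theorem integral_conj_eq_smul_finsum_fixedBy (hK : IsOpen (K : Set G)) (hKν : ν K ≠ ⊤) (f : G → E) (hf : support f ⊆ (K : Set G))
    (hfK : ∀ k ∈ K, ∀ x : G, f (k * x * k⁻¹) = f x) (hfin : (MulAction.fixedBy (G ⧸ K) γ).Finite) :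
    ∫ g, f (g * γ * g⁻¹) ∂ν = ν.real (K : Set G) • ∑ᶠ q ∈ MulAction.fixedBy (G ⧸ K) γ, f (q.out⁻¹ * γ * q.out) := by
  classical
  have hAm : ∀ q : G ⧸ K, MeasurableSet ((fun h : G => h * q.out) ⁻¹' (K : Set G)) := fun q =>
    (hK.preimage (continuous_mul_const _)).measurableSet
  have hA : ∀ q : G ⧸ K, ν ((fun h : G => h * q.out) ⁻¹' (K : Set G)) = ν K := fun q =>
    measure_preimage_mul_right ν q.out _
  simp_rw [conj_apply_eq_sum_indicator_fixedBy γ K f hf hfK hfin]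
  rw [integral_finsetSum _ fun q _ => ?_]
  · rw [finsum_mem_eq_finite_toFinset_sum _ hfin, Finset.smul_sum]
    refine Finset.sum_congr rfl fun q _ => ?_
    rw [integral_indicator_const _ (hAm q)]
    exact congrArg (fun r : ℝ≥0∞ => r.toReal • f (q.out⁻¹ * γ * q.out)) (hA q)
  · exact (integrable_indicator_iff (hAm q)).2 (integrableOn_const (hs := (hA q).symm ▸ hKν))

/-- **The plain-integral twin at a CLOSED class with COMPACT centraliser** (the currency of I-5b ★ `OrbitalIntegralSupportLocalisation` and I-6): for `K` compact open,
`∫_G f(h γ h⁻¹) dν(h) = ν(K) · Σ_{q ∈ Fix_γ(G⧸K)} f(q.out⁻¹ γ q.out)`, the fixed-point set being finite by ★ `finite_fixedBy_quotient_of_isClosed`.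
[cite: Laumon1995, Lemma (5.3.2) p. 136] [cite: Rogawski1990, §4.9 p. 54] -/
theorem integral_conj_eq_smul_finsum_fixedBy_of_isClosed [LocallyCompactSpace G] [SecondCountableTopology G] [T2Space G]
    [IsFiniteMeasureOnCompacts ν] [CompactSpace (Subgroup.centralizer ({γ} : Set G))] (hO : IsClosed {g | ∃ y : G, y * γ * y⁻¹ = g})
    (hK : IsOpen (K : Set G)) (hKc : IsCompact (K : Set G)) (f : G → E) (hf : support f ⊆ (K : Set G))
    (hfK : ∀ k ∈ K, ∀ x : G, f (k * x * k⁻¹) = f x) :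
    ∫ g, f (g * γ * g⁻¹) ∂ν = ν.real (K : Set G) • ∑ᶠ q ∈ MulAction.fixedBy (G ⧸ K) γ, f (q.out⁻¹ * γ * q.out) :=
  integral_conj_eq_smul_finsum_fixedBy γ K ν hK hKc.measure_lt_top.ne f hf hfK (finite_fixedBy_quotient_of_isClosed γ K hO hK hKc)

end Group

/-! ## §2 On `G ⧸ C_G(γ)`, `C_G(γ)` compact: `O_γ^{ν∕t}(f) = (ν(K)∕t(C)) · Σ_{q ∈ Fix} f(q.out⁻¹ γ q.out)` -/

section Compact

variable {G : Type*} [Group G] [TopologicalSpace G] [IsTopologicalGroup G] [LocallyCompactSpace G]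
  [SecondCountableTopology G] [T2Space G] [MeasurableSpace G] [BorelSpace G]
  (γ : G) (K : Subgroup G)
  [MeasurableSpace (G ⧸ Subgroup.centralizer ({γ} : Set G))]
  [BorelSpace (G ⧸ Subgroup.centralizer ({γ} : Set G))]
  [hC : IsClosed ((Subgroup.centralizer ({γ} : Set G) : Subgroup G) : Set G)]
  (t : Measure (Subgroup.centralizer ({γ} : Set G))) [t.IsMulLeftInvariant]
  [IsFiniteMeasureOnCompacts t] [t.IsOpenPosMeasure] [t.IsInvInvariant] [SFinite t]
  (ν : Measure G) [IsHaarMeasure ν] [ν.IsMulRightInvariant]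
  [CompactSpace (Subgroup.centralizer ({γ} : Set G))]
  {E : Type*} [NormedAddCommGroup E] [NormedSpace ℝ E] [CompleteSpace E]

/-- **THE WEIGHTED ORBITAL INTEGRAL AT A COMPACT CENTRALISER IS A FIXED-POINT SUM**: for `K` compact open, `f : G → E` CONTINUOUS, supported in `K` and
`K`-conjugation invariant, and finitely many fixed points, `O_γ^{ν∕t}(f) = (ν(K)∕t(C_G(γ)))·Σ_{q ∈ Fix_γ(G⧸K)} f(q.out⁻¹ γ q.out)` — ★ `integral_quotientMeasure_eq_inv_smul`
(`C` compact) and §1. [cite: Rogawski1990, §4.9 p. 54] [cite: Laumon1995, Lemma (5.3.2) p. 136] [cite: Folland1995, §2.6 (2.52)] -/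
theorem orbitalIntegral_quotientMeasure_eq_smul_finsum_fixedBy (hK : IsOpen (K : Set G)) (hKc : IsCompact (K : Set G))
    (f : G → E) (hfc : Continuous f) (hf : support f ⊆ (K : Set G)) (hfK : ∀ k ∈ K, ∀ x : G, f (k * x * k⁻¹) = f x)
    (hfin : (MulAction.fixedBy (G ⧸ K) γ).Finite) :
    orbitalIntegral γ f (quotientMeasure (Subgroup.centralizer ({γ} : Set G)) t hC ν) =
      ((t.real Set.univ)⁻¹ * ν.real (K : Set G)) • ∑ᶠ q ∈ MulAction.fixedBy (G ⧸ K) γ, f (q.out⁻¹ * γ * q.out) := by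
  rw [orbitalIntegral_eq_integral_descConj,
    integral_quotientMeasure_eq_inv_smul (Subgroup.centralizer ({γ} : Set G)) t ν _
      (continuous_descConj γ _ _ hfc).stronglyMeasurable]
  simp only [descConj_mk]
  rw [integral_conj_eq_smul_finsum_fixedBy γ K ν hK hKc.measure_lt_top.ne f hf hfK hfin, smul_smul]

end Compact

/-! ## §3 The class reading for a canonical family -/

section Canonical

variable {G : Type*} [Group G] [TopologicalSpace G] [IsTopologicalGroup G] [LocallyCompactSpace G]
  [SecondCountableTopology G] [T2Space G] [MeasurableSpace G] [BorelSpace G]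
  [∀ γ : G, MeasurableSpace (G ⧸ Subgroup.centralizer ({γ} : Set G))]
  [∀ γ : G, BorelSpace (G ⧸ Subgroup.centralizer ({γ} : Set G))]
  {E : Type*} [NormedAddCommGroup E] [NormedSpace ℝ E] [CompleteSpace E]

/-- **(U1) WEIGHTED FINITE-GROUP UNFOLDING — THE CLASS READING: `classOrbitalIntegral m f ⟦γ⟧ = ν(K) · Σ_{q ∈ Fix_γ(G⧸K)} f(q.out⁻¹ γ q.out)`** for a
family `m` CANONICAL for `(P, ν)` (★ `OrbitalMeasureFamily.IsCanonical`: mass one on the compact core of the centraliser), `P` conjugation-invariant with `P γ`,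
`ν` an ARBITRARY Haar measure (the mass `ν.real K` is carried — architect A-p16 (g27) RULING A-4 (b): the two vertex stabilisers of the road enter with their own
masses), `C_G(γ)` COMPACT, the class of `γ` CLOSED (so the fixed-point set is finite, ★ `finite_fixedBy_quotient_of_isClosed`), `K` compact open, and `f : G → E`
continuous, supported in `K` and `K`-conjugation invariant (a class function through `K ⧸ K_m`).  The weighted twin of ★ `classOrbitalIntegral_indicator_eq_card_fixedBy`
(B-p12 (g29) census §1 (U1)). [cite: Rogawski1990, §4.9 p. 54, §4.3 p. 43] [cite: Laumon1995, Lemma (5.3.2) p. 136] [cite: Kottwitz1986, §3] -/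
theorem classOrbitalIntegral_eq_sum_fixedBy_of_support_subset_of_conj_invariant {P : G → Prop} (hP : ∀ g x : G, P g → P (x * g * x⁻¹))
    {ν : Measure G} [ν.IsHaarMeasure] [ν.IsMulRightInvariant] {m : OrbitalMeasureFamily G} (hm : m.IsCanonical P ν)
    {γ : G} (hγ : P γ) [CompactSpace (Subgroup.centralizer ({γ} : Set G))] (K : Subgroup G) (hK : IsOpen (K : Set G))
    (hKc : IsCompact (K : Set G)) (hO : IsClosed {g | ∃ y : G, y * γ * y⁻¹ = g})
    (f : G → E) (hfc : Continuous f) (hf : support f ⊆ (K : Set G)) (hfK : ∀ k ∈ K, ∀ x : G, f (k * x * k⁻¹) = f x) :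
    classOrbitalIntegral m f (ConjClasses.mk γ) = ν.real (K : Set G) • ∑ᶠ q ∈ MulAction.fixedBy (G ⧸ K) γ, f (q.out⁻¹ * γ * q.out) := by
  haveI : BorelSpace (Subgroup.centralizer ({γ} : Set G)) := Subtype.borelSpace _
  let K₀ : TopologicalSpace.PositiveCompacts (Subgroup.centralizer ({γ} : Set G)) :=
    ⟨⟨Set.univ, isCompact_univ⟩, by rw [interior_univ]; exact univ_nonempty⟩
  haveI : (haarMeasure K₀).IsInvInvariant := isInvInvariant_of_compactSpace _
  have h1 : haarMeasure K₀ Set.univ = 1 := haarMeasure_self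
  have hcore : haarMeasure K₀ (compactCore (Subgroup.centralizer ({γ} : Set G))) = 1 := by
    rw [compactCore_eq_univ]; exact h1
  haveI : IsClosed ((Subgroup.centralizer ({γ} : Set G) : Subgroup G) : Set G) := isClosed_coe_centralizer_singleton γ
  rw [hm.classOrbitalIntegral_mk_eq_orbitalIntegral' hP hγ (haarMeasure K₀) hcore,
    orbitalIntegral_quotientMeasure_eq_smul_finsum_fixedBy γ K (haarMeasure K₀) ν hK hKc f hfc hf hfK
      (finite_fixedBy_quotient_of_isClosed γ K hO hK hKc),
    Measure.real, h1, ENNReal.toReal_one, inv_one, one_mul]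

/-- **The unit-mass corollary** (`ν(K) = 1`, B-p12 (g29) census §1 (U1) head verbatim): `classOrbitalIntegral m f ⟦γ⟧ = Σ_{q ∈ Fix_γ(G⧸K)} f(q.out⁻¹ γ q.out)`.
[cite: Rogawski1990, §4.9 p. 54, §4.3 p. 43] [cite: Laumon1995, Lemma (5.3.2) p. 136] -/
theorem classOrbitalIntegral_eq_sum_fixedBy_of_support_subset_of_conj_invariant_of_measure_eq_one {P : G → Prop}
    (hP : ∀ g x : G, P g → P (x * g * x⁻¹))
    {ν : Measure G} [ν.IsHaarMeasure] [ν.IsMulRightInvariant] {m : OrbitalMeasureFamily G} (hm : m.IsCanonical P ν)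
    {γ : G} (hγ : P γ) [CompactSpace (Subgroup.centralizer ({γ} : Set G))] (K : Subgroup G) (hK : IsOpen (K : Set G))
    (hKc : IsCompact (K : Set G)) (hν : ν K = 1) (hO : IsClosed {g | ∃ y : G, y * γ * y⁻¹ = g})
    (f : G → E) (hfc : Continuous f) (hf : support f ⊆ (K : Set G)) (hfK : ∀ k ∈ K, ∀ x : G, f (k * x * k⁻¹) = f x) :
    classOrbitalIntegral m f (ConjClasses.mk γ) = ∑ᶠ q ∈ MulAction.fixedBy (G ⧸ K) γ, f (q.out⁻¹ * γ * q.out) := by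
  rw [classOrbitalIntegral_eq_sum_fixedBy_of_support_subset_of_conj_invariant hP hm hγ K hK hKc hO f hfc hf hfK, Measure.real, hν,
    ENNReal.toReal_one, one_smul]

end Canonical

end Literature.NumberTheory.Automorphic

end
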